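/-
Copyright (c) 2026 the pub-hodgecm-mathlib formalisation cell (harness21).  Prover seat hodgecm-mathlib-K2Liu-p03 (g6): Track B «K2-LIT»,
#184♮ = hLiu418 = stmt-HodgeConjecture-24832, road `K2_Liu`, Road I organ (A-int)-fin, A7-reg (GK COCYCLE road), file B1b-2d
(K2Liu-p09 (g5) 2026-09-04T08:33:55Z (L1)(L2) for the Weyl ∕ root letters of the `GL₂`-type step and (L3): continuity of the transported root letters).
-/
import Summits.HodgeConjecture.HodgeConjecture.Theorems.K2LiuDoubledUTwoTwoLeviTransport      -- ★ B1b-2c: `…_frameConj_of_blocks` (generic block-diagonal letter)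
import Summits.HodgeConjecture.HodgeConjecture.Theorems.K2LiuDoubledUTwoTwoUnipotentHaar       -- ★ B1b-2b: `continuous_unitaryOfMatrix'`
import HarnessLib

/-!
# Crux `HLiu418`, road `K2_Liu`, organ (A-int)-fin, A7-reg file B1b-2d: THE TRANSPORTED WEYL LETTER `w₁` AND ROOT LETTER `u_−(z)` LIE IN `P_Δ(F_v)` WITH
# SIEGEL CHARACTER `∏_w χ_w(−1)` ∕ `1`, AND THE TRANSPORTED ROOT LETTERS ARE CONTINUOUS

Cell `hodgecm-mathlib`, crux item hLiu418 = `stmt-HodgeConjecture-24832`; squad K2 ∕ K2Liu; prover K2Liu-p03 (g6).  THEOREMS ONLY (no `def`, no instance,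
no notation, no named-fact hypothesis, no `sorry`); lane `--supports stmt-HodgeConjecture-24832 --as helper`.  Sequel of ★ B1b-2c `K2LiuDoubledUTwoTwoLeviTransport`.

Setting of ★ B1b-1∕2a∕2b∕2c: `H_v = U(T₂ ⊕ −T₂)(F_v)`, rational frame `Q = e₂∘(1 D; 1 −D)` (`D Dinv = 1`), `φ := frameConj Q ∘ toLocalFour : U(J₄)(E ⊗ F_v) → H_v`.
* §1 THE WEYL LETTER `w₁` of the `GL₂`-type step (K2Liu-p09's (L1)(L2)): blocked matrix `diag((0 1; 1 0), (0 1; 1 0))`, so `φ(w₁) ∈ P_Δ(F_v)` is a Levi element,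
  `|det_Δ φ(w₁)|_v = 1`, `χ_v(det_Δ φ(w₁)) = ∏_w χ_w(−1)`, `localSiegelCharacter χ_v s (φ w₁) = ∏_w χ_w(−1)`.
* §2 THE ROOT LETTER `u_−(z)` (Levi unipotent): `φ(u_−(z)) ∈ P_Δ(F_v)`, `|det_Δ|_v = 1`, `χ_v(det_Δ) = 1`, `localSiegelCharacter χ_v s (φ u_−(z)) = 1` — Siegel sections are
  left-invariant under it.
* §3 CONTINUITY (K2Liu-p09's (L3)): `g ↦ φ g`, `z ↦ φ(u_−(z))`, `z ↦ φ(u_+(z))`, `b ↦ φ(u₂(ι_v(b)δ))`, `b ↦ φ(u₁(ι_v(b)δ))` are continuous (★ B1b-2b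
  `continuous_unitaryOfMatrix'`, the letters being polynomial in their argument and `σ = c ⊗ 1` continuous).
HONEST LABEL.  Count-neutral helper: `HC_CM` is proved only modulo the 7 printed citations (2 remaining named inputs: hLiu418 = `stmt-HodgeConjecture-24832`,
h413 = `stmt-HodgeConjecture-24833`) until rung 0 closes.

## References
* [Casselman1980] W. Casselman, Compositio 40 (1980): §3 (rank-one reduction of intertwining operators, torus characters).
* [Rogawski1990] J. Rogawski, *Automorphic Representations of Unitary Groups in Three Variables* (1990): §1.9 (root subgroups of quasi-split unitary groups).
* [HarrisKudlaSweet1996] M. Harris, S. Kudla, W. J. Sweet, J. AMS 9 (1996): §1 (1.15).   * [Weil1965] A. Weil, *L'intégration dans les groupes topologiques* (1965): §37.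
-/

set_option autoImplicit false
set_option linter.dupNamespace false -- the mandated namespace repeats `HodgeConjecture.HodgeConjecture`

noncomputable section

open NumberField IsDedekindDomain Matrix Topology
open Literature.NumberTheory.Automorphic Literature.NumberTheory.Automorphic.UnitaryGroup
open Literature.NumberTheory.GelbartRogawski1991.AdaptedBlocks
open Literature.NumberTheory.GelbartRogawski1991.UnitaryDualPair.LocalSplitting
open Literature.NumberTheory.K2Lit.LocalSiegelDoubled
open Summit.HodgeConjecture.HodgeConjecture.Cruxes.HLiu418.K2LiuLocalSiegelIwasawa
open Summit.HodgeConjecture.HodgeConjecture.Cruxes.HLiu418.K2LiuDoubledUTwoTwoBorelFrame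
open Summit.HodgeConjecture.HodgeConjecture.Cruxes.HLiu418.K2LiuDoubledUTwoTwoWeylCocycle
open Summit.HodgeConjecture.HodgeConjecture.Cruxes.HLiu418.K2LiuDoubledUTwoTwoLevi
open Summit.HodgeConjecture.HodgeConjecture.Cruxes.HLiu418.K2LiuDoubledUTwoTwoFrameTransport
open Summit.HodgeConjecture.HodgeConjecture.Cruxes.HLiu418.K2LiuUnipDeltaRankOneCoordinates
open Summit.HodgeConjecture.HodgeConjecture.Cruxes.HLiu418.K2LiuDoubledUTwoTwoUnipotentHaar
open Summit.HodgeConjecture.HodgeConjecture.Cruxes.HLiu418.K2LiuDoubledUTwoTwoLeviTransport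

namespace Summit.HodgeConjecture.HodgeConjecture.Cruxes.HLiu418.K2LiuDoubledUTwoTwoLetterTransport

variable (F : Type) [Field F] [NumberField F] (E : Type) [Field E] [NumberField E] [Algebra F E]
  [Algebra.IsQuadraticExtension F E] (c : E ≃ₐ[F] E)
  {δ : E} (hcδ : c δ = -δ) (hδ : δ ≠ 0) {d : F} (hd : δ * δ = algebraMap F E d) (v : HeightOneSpectrum (𝓞 F))
  {T₂ : Matrix (Fin 2) (Fin 2) F} (hT₂ : T₂.IsSymm) {J₂D : Matrix (Fin (2 + 2)) (Fin (2 + 2)) E} (hJ₂D : J₂D = (gramD F 2 T₂).map (algebraMap F E))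
  (D Dinv : Matrix (Fin 2) (Fin 2) F) (hDD : D * Dinv = 1) (Q : GL (Fin (2 + 2)) F)
  (hQm : (Q : Matrix (Fin (2 + 2)) (Fin (2 + 2)) F) = Matrix.reindex (e₂ 2) (e₂ 2) (Matrix.fromBlocks 1 D 1 (-D)))
  (hQ : (Q : Matrix (Fin (2 + 2)) (Fin (2 + 2)) F)ᵀ * gramD F 2 T₂ * (Q : Matrix (Fin (2 + 2)) (Fin (2 + 2)) F) = (StdForm.antidiagonal (2 + 2)).over F)

/-! ## §1 The Weyl letter `w₁` of the `GL₂`-type step -/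

omit [Algebra.IsQuadraticExtension F E] in
/-- blocked matrix of `w₁`: `diag((0 1; 1 0), (0 1; 1 0))`. [cite: Casselman1980, §3] -/
theorem reindex_weylOne :
    Matrix.reindex (e₂ 2).symm (e₂ 2).symm
        ((weylOne (UnitaryGroup.LocalRing E v) (UnitaryGroup.conjLocal E c v) : unitaryGroupOfForm _ _) : GL (Fin 4) (UnitaryGroup.LocalRing E v)).1 =
      Matrix.fromBlocks !![0, 1; 1, 0] 0 0 !![0, 1; 1, 0] := by
  rw [coe_weylOne]
  ext i j
  rcases i with i | i <;> rcases j with j | j <;> fin_cases i <;> fin_cases j <;> rfl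

include hJ₂D hDD hQm in
/-- **(L1) `Q w₁ Q⁻¹ ∈ P_Δ(F_v)`** (a Levi element: the Weyl element of the `GL₂`-type step). [cite: Casselman1980, §3] -/
theorem isSiegelDelta_frameConj_weylOne :
    IsSiegelDelta F E c hcδ hδ hd v 2 hT₂ hJ₂D (FrameTransport.frameConj F E c v (2 + 2) hJ₂D (antidiagonal_over_eq_map F E 2) Q hQ
      (toLocalFour F E c v (weylOne (UnitaryGroup.LocalRing E v) (UnitaryGroup.conjLocal E c v)))) :=
  isSiegelDelta_frameConj_of_blocks F E c hcδ hδ hd v hT₂ hJ₂D D Dinv hDD Q hQm hQ _ _ _ (reindex_weylOne F E c v)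

omit [Algebra.IsQuadraticExtension F E] in
include hJ₂D hDD hQm in
/-- `Q w₁ Q⁻¹` is a Levi element with `Δ`-block `(0 1; 1 0)`. [cite: Casselman1980, §3] -/
theorem blocks_matA_frameConj_weylOne :
    blkA (matA F E c v 2 (FrameTransport.frameConj F E c v (2 + 2) hJ₂D (antidiagonal_over_eq_map F E 2) Q hQ
        (toLocalFour F E c v (weylOne (UnitaryGroup.LocalRing E v) (UnitaryGroup.conjLocal E c v))))) = !![0, 1; 1, 0] ∧
      blkB (matA F E c v 2 (FrameTransport.frameConj F E c v (2 + 2) hJ₂D (antidiagonal_over_eq_map F E 2) Q hQ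
        (toLocalFour F E c v (weylOne (UnitaryGroup.LocalRing E v) (UnitaryGroup.conjLocal E c v))))) = 0 ∧
      blkC (matA F E c v 2 (FrameTransport.frameConj F E c v (2 + 2) hJ₂D (antidiagonal_over_eq_map F E 2) Q hQ
        (toLocalFour F E c v (weylOne (UnitaryGroup.LocalRing E v) (UnitaryGroup.conjLocal E c v))))) = 0 := by
  obtain ⟨h1, h2, h3, -⟩ := blocks_matA_frameConj_of_blocks F E c v hJ₂D D Dinv hDD Q hQm hQ _ _ _ (reindex_weylOne F E c v)
  exact ⟨h1, h2, h3⟩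

omit [NumberField F] [Algebra.IsQuadraticExtension F E] in
/-- `det (0 1; 1 0) = −1`. [folklore] -/
theorem det_antidiagTwo_unit :
    ((-1 : (UnitaryGroup.LocalRing E v)ˣ) : UnitaryGroup.LocalRing E v) = (!![0, 1; 1, 0] : Matrix (Fin 2) (Fin 2) (UnitaryGroup.LocalRing E v)).det := by
  rw [Matrix.det_fin_two_of, Units.val_neg, Units.val_one]; ring

omit [Algebra.IsQuadraticExtension F E] in
include hJ₂D hDD hQm in
/-- **`|det_Δ(Q w₁ Q⁻¹)|_v = 1`**. [cite: Casselman1980, §3] -/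
theorem absDetDelta_frameConj_weylOne :
    absDetDelta F E c v 2 (FrameTransport.frameConj F E c v (2 + 2) hJ₂D (antidiagonal_over_eq_map F E 2) Q hQ
        (toLocalFour F E c v (weylOne (UnitaryGroup.LocalRing E v) (UnitaryGroup.conjLocal E c v)))) = 1 := by
  rw [absDetDelta_frameConj_of_blocks F E c v hJ₂D D Dinv hDD Q hQm hQ _ _ _ (reindex_weylOne F E c v)]
  refine Finset.prod_eq_one fun w _ => ?_
  rw [← det_antidiagTwo_unit, Units.val_neg, Units.val_one, Pi.neg_apply, Pi.one_apply, norm_neg, norm_one]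

omit [Algebra.IsQuadraticExtension F E] in
include hJ₂D hDD hQm in
/-- **`χ_v(det_Δ(Q w₁ Q⁻¹)) = ∏_w χ_w(−1)`**. [cite: Casselman1980, §3] [cite: HarrisKudlaSweet1996, §1 (1.15)] -/
theorem chiDet_frameConj_weylOne (χv : ∀ w : PlacesOver E v, (w.1.adicCompletion E)ˣ →* ℂˣ) :
    chiDet F E c v 2 χv (FrameTransport.frameConj F E c v (2 + 2) hJ₂D (antidiagonal_over_eq_map F E 2) Q hQ
        (toLocalFour F E c v (weylOne (UnitaryGroup.LocalRing E v) (UnitaryGroup.conjLocal E c v)))) = ∏ w : PlacesOver E v, χv w (-1) := by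
  rw [chiDet_frameConj_of_blocks F E c v hJ₂D D Dinv hDD Q hQm hQ _ _ _ (reindex_weylOne F E c v) χv _ (det_antidiagTwo_unit F E v)]
  exact Finset.prod_congr rfl fun w _ => congrArg (χv w) (Units.ext rfl)

omit [Algebra.IsQuadraticExtension F E] in
include hJ₂D hDD hQm in
/-- **(L2) `χ_v(det_Δ)|det_Δ|_v^{s+1}(Q w₁ Q⁻¹) = ∏_w χ_w(−1)`** (no modulus). [cite: Casselman1980, §3] -/
theorem localSiegelCharacter_frameConj_weylOne (χv : ∀ w : PlacesOver E v, (w.1.adicCompletion E)ˣ →* ℂˣ) (s : ℂ) :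
    localSiegelCharacter F E c v 2 χv s (FrameTransport.frameConj F E c v (2 + 2) hJ₂D (antidiagonal_over_eq_map F E 2) Q hQ
        (toLocalFour F E c v (weylOne (UnitaryGroup.LocalRing E v) (UnitaryGroup.conjLocal E c v)))) = ∏ w : PlacesOver E v, ((χv w (-1) : ℂˣ) : ℂ) := by
  unfold localSiegelCharacter
  rw [chiDet_frameConj_weylOne F E c v hJ₂D D Dinv hDD Q hQm hQ χv, absDetDelta_frameConj_weylOne F E c v hJ₂D D Dinv hDD Q hQm hQ, Units.coe_prod,
    Complex.ofReal_one, Complex.one_cpow, mul_one]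

/-! ## §2 The root letter `u_−(z)` of the `GL₂`-type step (a Levi unipotent) -/

/-- blocked matrix of `u_−(z)`: `diag((1 z; 0 1), (1 −σz; 0 1))`. [cite: Rogawski1990, §1.9] -/
theorem reindex_uMinus (z : UnitaryGroup.LocalRing E v) :
    Matrix.reindex (e₂ 2).symm (e₂ 2).symm
        ((uMinus (UnitaryGroup.LocalRing E v) (UnitaryGroup.conjLocal E c v) (UnitaryGroup.conjLocal_conjLocal c v hcδ hδ) z :
          unitaryGroupOfForm _ _) : GL (Fin 4) (UnitaryGroup.LocalRing E v)).1 =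
      Matrix.fromBlocks !![1, z; 0, 1] 0 0 !![1, -UnitaryGroup.conjLocal E c v z; 0, 1] := by
  rw [coe_uMinus]
  ext i j
  rcases i with i | i <;> rcases j with j | j <;> fin_cases i <;> fin_cases j <;> rfl

include hJ₂D hDD hQm in
/-- **(L1) `Q u_−(z) Q⁻¹ ∈ P_Δ(F_v)`** (the root letter of the `GL₂`-type step is a Levi unipotent). [cite: Rogawski1990, §1.9] [cite: Casselman1980, §3] -/
theorem isSiegelDelta_frameConj_uMinus (z : UnitaryGroup.LocalRing E v) :
    IsSiegelDelta F E c hcδ hδ hd v 2 hT₂ hJ₂D (FrameTransport.frameConj F E c v (2 + 2) hJ₂D (antidiagonal_over_eq_map F E 2) Q hQ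
      (toLocalFour F E c v (uMinus (UnitaryGroup.LocalRing E v) (UnitaryGroup.conjLocal E c v) (UnitaryGroup.conjLocal_conjLocal c v hcδ hδ) z))) :=
  isSiegelDelta_frameConj_of_blocks F E c hcδ hδ hd v hT₂ hJ₂D D Dinv hDD Q hQm hQ _ _ _ (reindex_uMinus F E c hcδ hδ v z)

include hJ₂D hDD hQm in
/-- `Q u_−(z) Q⁻¹` is a Levi element with `Δ`-block `(1 z; 0 1)`. [cite: Rogawski1990, §1.9] -/
theorem blocks_matA_frameConj_uMinus (z : UnitaryGroup.LocalRing E v) :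
    blkA (matA F E c v 2 (FrameTransport.frameConj F E c v (2 + 2) hJ₂D (antidiagonal_over_eq_map F E 2) Q hQ
        (toLocalFour F E c v (uMinus (UnitaryGroup.LocalRing E v) (UnitaryGroup.conjLocal E c v) (UnitaryGroup.conjLocal_conjLocal c v hcδ hδ) z)))) =
        !![1, z; 0, 1] ∧
      blkB (matA F E c v 2 (FrameTransport.frameConj F E c v (2 + 2) hJ₂D (antidiagonal_over_eq_map F E 2) Q hQ
        (toLocalFour F E c v (uMinus (UnitaryGroup.LocalRing E v) (UnitaryGroup.conjLocal E c v) (UnitaryGroup.conjLocal_conjLocal c v hcδ hδ) z)))) = 0 ∧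
      blkC (matA F E c v 2 (FrameTransport.frameConj F E c v (2 + 2) hJ₂D (antidiagonal_over_eq_map F E 2) Q hQ
        (toLocalFour F E c v (uMinus (UnitaryGroup.LocalRing E v) (UnitaryGroup.conjLocal E c v) (UnitaryGroup.conjLocal_conjLocal c v hcδ hδ) z)))) = 0 := by
  obtain ⟨h1, h2, h3, -⟩ := blocks_matA_frameConj_of_blocks F E c v hJ₂D D Dinv hDD Q hQm hQ _ _ _ (reindex_uMinus F E c hcδ hδ v z)
  exact ⟨h1, h2, h3⟩

omit [NumberField F] [Algebra.IsQuadraticExtension F E] in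
/-- `det (1 z; 0 1) = 1`. [folklore] -/
theorem det_unipTwo_unit (z : UnitaryGroup.LocalRing E v) :
    ((1 : (UnitaryGroup.LocalRing E v)ˣ) : UnitaryGroup.LocalRing E v) = (!![1, z; 0, 1] : Matrix (Fin 2) (Fin 2) (UnitaryGroup.LocalRing E v)).det := by
  rw [Matrix.det_fin_two_of, Units.val_one]; ring

include hJ₂D hDD hQm in
/-- **`|det_Δ(Q u_−(z) Q⁻¹)|_v = 1`**. [cite: Rogawski1990, §1.9] -/
theorem absDetDelta_frameConj_uMinus (z : UnitaryGroup.LocalRing E v) :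
    absDetDelta F E c v 2 (FrameTransport.frameConj F E c v (2 + 2) hJ₂D (antidiagonal_over_eq_map F E 2) Q hQ
        (toLocalFour F E c v (uMinus (UnitaryGroup.LocalRing E v) (UnitaryGroup.conjLocal E c v) (UnitaryGroup.conjLocal_conjLocal c v hcδ hδ) z))) = 1 := by
  rw [absDetDelta_frameConj_of_blocks F E c v hJ₂D D Dinv hDD Q hQm hQ _ _ _ (reindex_uMinus F E c hcδ hδ v z)]
  refine Finset.prod_eq_one fun w _ => ?_
  rw [← det_unipTwo_unit, Units.val_one, Pi.one_apply, norm_one]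

include hJ₂D hDD hQm in
/-- **`χ_v(det_Δ(Q u_−(z) Q⁻¹)) = 1`**. [cite: Rogawski1990, §1.9] [cite: HarrisKudlaSweet1996, §1 (1.15)] -/
theorem chiDet_frameConj_uMinus (χv : ∀ w : PlacesOver E v, (w.1.adicCompletion E)ˣ →* ℂˣ) (z : UnitaryGroup.LocalRing E v) :
    chiDet F E c v 2 χv (FrameTransport.frameConj F E c v (2 + 2) hJ₂D (antidiagonal_over_eq_map F E 2) Q hQ
        (toLocalFour F E c v (uMinus (UnitaryGroup.LocalRing E v) (UnitaryGroup.conjLocal E c v) (UnitaryGroup.conjLocal_conjLocal c v hcδ hδ) z))) = 1 := by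
  rw [chiDet_frameConj_of_blocks F E c v hJ₂D D Dinv hDD Q hQm hQ _ _ _ (reindex_uMinus F E c hcδ hδ v z) χv _ (det_unipTwo_unit F E v z)]
  exact Finset.prod_eq_one fun w _ => by rw [map_one, map_one]

include hJ₂D hDD hQm in
/-- **(L2) `χ_v(det_Δ)|det_Δ|_v^{s+1}(Q u_−(z) Q⁻¹) = 1`**: Siegel sections are LEFT-INVARIANT under the transported `GL₂`-type root letters.
[cite: Rogawski1990, §1.9] [cite: Casselman1980, §3] -/
theorem localSiegelCharacter_frameConj_uMinus (χv : ∀ w : PlacesOver E v, (w.1.adicCompletion E)ˣ →* ℂˣ) (s : ℂ) (z : UnitaryGroup.LocalRing E v) :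
    localSiegelCharacter F E c v 2 χv s (FrameTransport.frameConj F E c v (2 + 2) hJ₂D (antidiagonal_over_eq_map F E 2) Q hQ
        (toLocalFour F E c v (uMinus (UnitaryGroup.LocalRing E v) (UnitaryGroup.conjLocal E c v) (UnitaryGroup.conjLocal_conjLocal c v hcδ hδ) z))) = 1 := by
  unfold localSiegelCharacter
  rw [chiDet_frameConj_uMinus F E c hcδ hδ v hJ₂D D Dinv hDD Q hQm hQ χv z, absDetDelta_frameConj_uMinus F E c hcδ hδ v hJ₂D D Dinv hDD Q hQm hQ z, Units.val_one,
    Complex.ofReal_one, Complex.one_cpow, mul_one]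

/-! ## §3 Continuity of the transported root letters -/

omit [Algebra.IsQuadraticExtension F E] in
/-- `g ↦ Q g Q⁻¹ : U(J₄)(E ⊗ F_v) → H_v` is continuous. [cite: Weil1965, §37] -/
theorem continuous_frameConj_toLocalFour :
    Continuous fun g : unitaryGroupOfForm (UnitaryGroup.conjLocal E c v) ((StdForm.antidiagonal 4).over (UnitaryGroup.LocalRing E v)) =>
      FrameTransport.frameConj F E c v (2 + 2) hJ₂D (antidiagonal_over_eq_map F E 2) Q hQ (toLocalFour F E c v g) :=
  (FrameTransport.frameConj F E c v (2 + 2) hJ₂D (antidiagonal_over_eq_map F E 2) Q hQ).continuous.comp (toLocalFour F E c v).continuous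

/-- **(L3) `z ↦ Q u_−(z) Q⁻¹` is continuous on `E ⊗ F_v`**. [cite: Weil1965, §37] -/
theorem continuous_frameConj_uMinus :
    Continuous fun z : UnitaryGroup.LocalRing E v => FrameTransport.frameConj F E c v (2 + 2) hJ₂D (antidiagonal_over_eq_map F E 2) Q hQ
      (toLocalFour F E c v (uMinus (UnitaryGroup.LocalRing E v) (UnitaryGroup.conjLocal E c v) (UnitaryGroup.conjLocal_conjLocal c v hcδ hδ) z)) := by
  have hM : Continuous fun z : UnitaryGroup.LocalRing E v => uMinusM (UnitaryGroup.LocalRing E v) (UnitaryGroup.conjLocal E c v) z := by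
    refine continuous_matrix fun i j => ?_
    fin_cases i <;> fin_cases j <;> simp [uMinusM] <;>
      first | exact continuous_const | exact continuous_id | exact (UnitaryGroup.continuous_conjLocal E c v).neg
  exact (continuous_frameConj_toLocalFour F E c v hJ₂D Q hQ).comp (continuous_unitaryOfMatrix' F E c v _ _ hM)

/-- **(L3) `z ↦ Q u_+(z) Q⁻¹` is continuous on `E ⊗ F_v`**. [cite: Weil1965, §37] -/
theorem continuous_frameConj_uPlus :
    Continuous fun z : UnitaryGroup.LocalRing E v => FrameTransport.frameConj F E c v (2 + 2) hJ₂D (antidiagonal_over_eq_map F E 2) Q hQ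
      (toLocalFour F E c v (uPlus (UnitaryGroup.LocalRing E v) (UnitaryGroup.conjLocal E c v) (UnitaryGroup.conjLocal_conjLocal c v hcδ hδ) z)) := by
  have hM : Continuous fun z : UnitaryGroup.LocalRing E v => uPlusM (UnitaryGroup.LocalRing E v) (UnitaryGroup.conjLocal E c v) z := by
    refine continuous_matrix fun i j => ?_
    fin_cases i <;> fin_cases j <;> simp [uPlusM] <;>
      first | exact continuous_const | exact continuous_id | exact (UnitaryGroup.continuous_conjLocal E c v).neg
  exact (continuous_frameConj_toLocalFour F E c v hJ₂D Q hQ).comp (continuous_unitaryOfMatrix' F E c v _ _ hM)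

omit [Algebra.IsQuadraticExtension F E] in
/-- **(L3) `b ↦ Q u₂(ι_v(b)δ) Q⁻¹` is continuous on `F_v`** (the root letter of the `U(1,1)`-type step in the rational coordinate). [cite: Weil1965, §37] -/
theorem continuous_frameConj_uLongTwo_coord :
    Continuous fun b : v.adicCompletion F => FrameTransport.frameConj F E c v (2 + 2) hJ₂D (antidiagonal_over_eq_map F E 2) Q hQ
      (toLocalFour F E c v (uLongTwo (UnitaryGroup.LocalRing E v) (UnitaryGroup.conjLocal E c v)
        (UnitaryGroup.toLocalRing E v b * algebraMap E (UnitaryGroup.LocalRing E v) δ) (conjLocal_coord F E c hcδ v b))) := by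
  have h1 : Continuous fun b : v.adicCompletion F => UnitaryGroup.toLocalRing E v b * algebraMap E (UnitaryGroup.LocalRing E v) δ :=
    (UnitaryGroup.continuous_toLocalRing E v).mul continuous_const
  have hM : Continuous fun b : v.adicCompletion F =>
      uLongTwoM (UnitaryGroup.LocalRing E v) (UnitaryGroup.toLocalRing E v b * algebraMap E (UnitaryGroup.LocalRing E v) δ) := by
    refine continuous_matrix fun i j => ?_
    fin_cases i <;> fin_cases j <;> simp [uLongTwoM] <;> first | exact continuous_const | exact h1
  exact (continuous_frameConj_toLocalFour F E c v hJ₂D Q hQ).comp (continuous_unitaryOfMatrix' F E c v _ _ hM)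

omit [Algebra.IsQuadraticExtension F E] in
/-- **(L3) `b ↦ Q u₁(ι_v(b)δ) Q⁻¹` is continuous on `F_v`**. [cite: Weil1965, §37] -/
theorem continuous_frameConj_uLongOne_coord :
    Continuous fun b : v.adicCompletion F => FrameTransport.frameConj F E c v (2 + 2) hJ₂D (antidiagonal_over_eq_map F E 2) Q hQ
      (toLocalFour F E c v (uLongOne (UnitaryGroup.LocalRing E v) (UnitaryGroup.conjLocal E c v)
        (UnitaryGroup.toLocalRing E v b * algebraMap E (UnitaryGroup.LocalRing E v) δ) (conjLocal_coord F E c hcδ v b))) := by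
  have h1 : Continuous fun b : v.adicCompletion F => UnitaryGroup.toLocalRing E v b * algebraMap E (UnitaryGroup.LocalRing E v) δ :=
    (UnitaryGroup.continuous_toLocalRing E v).mul continuous_const
  have hM : Continuous fun b : v.adicCompletion F =>
      uLongOneM (UnitaryGroup.LocalRing E v) (UnitaryGroup.toLocalRing E v b * algebraMap E (UnitaryGroup.LocalRing E v) δ) := by
    refine continuous_matrix fun i j => ?_
    fin_cases i <;> fin_cases j <;> simp [uLongOneM] <;> first | exact continuous_const | exact h1
  exact (continuous_frameConj_toLocalFour F E c v hJ₂D Q hQ).comp (continuous_unitaryOfMatrix' F E c v _ _ hM)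

end Summit.HodgeConjecture.HodgeConjecture.Cruxes.HLiu418.K2LiuDoubledUTwoTwoLetterTransport

end
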